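import Mathlib.MeasureTheory.Constructions.BorelSpace.Basic
import Mathlib.MeasureTheory.Measure.MeasureSpace
import Mathlib.Topology.ContinuousMap.SecondCountableSpace
import Mathlib.Topology.Metrizable.ContinuousMap
import Mathlib.Topology.UniformSpace.CompactConvergence
import Mathlib.Topology.MetricSpace.UniformConvergence
import HarnessLib

/-!
# Modulus-of-continuity events in path space: from "eventually in `n`" to "for all `n`"

Companion to `PathSpaceTightness` (tightness in `C([0, ∞), E)` from moduli of continuity,
Billingsley (1999), Thm. 7.3). Tightness criteria in the literature are stated with the
modulus condition holding for all indices `n ≥ n₀(T, ε, η)` only (Billingsley (1999), Thm. 7.3,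
condition (ii): "`∃ δ, n₀: P[w(Xₙ, δ) ≥ ε] ≤ η, n ≥ n₀`"; Lawler–Schramm–Werner (2004), Prop. 4.5:
"for all `R > R₀`"), because each single random continuous path satisfies it automatically.
We prove that upgrade:

* `Literature.Probability.Process.isClosed_badModulusSet` — the "bad modulus" set `badModulusSet T δ ε =`
  `{x | ∃ s, t ≤ T, dist s t ≤ δ, ε ≤ dist (x s) (x t)}` is closed in `C(ℝ≥0, E)`;
* `Literature.Probability.Process.tendsto_measure_badModulusSet` — for one random continuous
  path its probability tends to `0` as `δ ↓ 0` (paths are uniformly continuous on `[0, T]`);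
* `Literature.Probability.Process.exists_forall_measure_badModulusSet_le_of_eventually` (and the fully
  quantified `forall_measure_modulus_le_of_eventually`) — hence a modulus bound holding eventually in
  `n` holds for all `n` with a smaller `δ`.

## References

* P. Billingsley, *Convergence of Probability Measures*, 2nd ed. (1999), Thm. 7.3 and its proof
  ("(i) and (ii) hold, with `n₀ = 1` in each case … for the finitely many `n` preceding `n₀`").
-/

noncomputable section

open Set Filter Topology Metric MeasureTheory
open scoped NNReal ENNReal

namespace Literature.Probability.Process

variable {E : Type*} [PseudoMetricSpace E]

/-- The **bad-modulus set** of paths: some pair of times `s, t ≤ T` with `dist s t ≤ δ` has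
`ε ≤ dist (x s) (x t)`. [folklore] -/
def badModulusSet (T δ ε : ℝ) : Set C(ℝ≥0, E) :=
  {x | ∃ s t : ℝ≥0, (s : ℝ) ≤ T ∧ (t : ℝ) ≤ T ∧ dist s t ≤ δ ∧ ε ≤ dist (x s) (x t)}

/-- Membership in `badModulusSet`. [folklore] -/
theorem mem_badModulusSet {T δ ε : ℝ} {x : C(ℝ≥0, E)} :
    x ∈ badModulusSet T δ ε ↔
      ∃ s t : ℝ≥0, (s : ℝ) ≤ T ∧ (t : ℝ) ≤ T ∧ dist s t ≤ δ ∧ ε ≤ dist (x s) (x t) := Iff.rfl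

/-- `badModulusSet` is monotone in `δ`. [folklore] -/
theorem badModulusSet_mono {T δ δ' ε : ℝ} (h : δ ≤ δ') :
    (badModulusSet T δ ε : Set C(ℝ≥0, E)) ⊆ badModulusSet T δ' ε := by
  rintro x ⟨s, t, hs, ht, hst, hε⟩
  exact ⟨s, t, hs, ht, hst.trans h, hε⟩

/-- The times `≤ T` form a compact subset of `ℝ≥0` (a closed subset of `[0, max T 0]`).
[folklore] -/
theorem isCompact_setOf_coe_le (T : ℝ) : IsCompact {s : ℝ≥0 | (s : ℝ) ≤ T} := by
  refine (isCompact_Icc (a := (0 : ℝ≥0)) (b := (max T 0).toNNReal)).of_isClosed_subset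
    (isClosed_le NNReal.continuous_coe continuous_const) fun s hs ↦ ⟨bot_le, ?_⟩
  rw [← NNReal.coe_le_coe, Real.coe_toNNReal _ (le_max_right _ _)]
  exact le_trans hs (le_max_left _ _)

/-- Along a convergent sequence of paths `xₙ → y` (locally uniformly) and convergent times
`sₙ → s₀` in `[0, T]`, `xₙ(sₙ) → y(s₀)`. [folklore] -/
theorem tendsto_apply_of_tendsto {x : ℕ → C(ℝ≥0, E)} {y : C(ℝ≥0, E)}
    (hlim : Tendsto x atTop (𝓝 y)) {T : ℝ} {s : ℕ → ℝ≥0} (hs : ∀ n, (s n : ℝ) ≤ T) {s₀ : ℝ≥0}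
    (hs₀ : Tendsto s atTop (𝓝 s₀)) : Tendsto (fun n ↦ x n (s n)) atTop (𝓝 (y s₀)) := by
  have hunif : TendstoUniformlyOn (fun n (a : ℝ≥0) ↦ x n a) y atTop {s : ℝ≥0 | (s : ℝ) ≤ T} :=
    (ContinuousMap.tendsto_iff_forall_isCompact_tendstoUniformlyOn.1 hlim) _
      (isCompact_setOf_coe_le T)
  exact hunif.tendsto_comp y.continuous.continuousWithinAt
    (tendsto_nhdsWithin_iff.2 ⟨hs₀, Eventually.of_forall hs⟩)

/-- **The bad-modulus set is closed** in `C(ℝ≥0, E)`: if `xₙ → y` locally uniformly and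
`xₙ` has times `sₙ, tₙ ≤ T`, `dist sₙ tₙ ≤ δ` with `ε ≤ dist (xₙ sₙ) (xₙ tₙ)`, a subsequence of the
times converges (compactness of `[0, T]²`) and uniform convergence on `[0, T]` passes the
inequality to the limit. [folklore] -/
theorem isClosed_badModulusSet (T δ ε : ℝ) : IsClosed (badModulusSet T δ ε : Set C(ℝ≥0, E)) := by
  refine IsSeqClosed.isClosed fun x y hx hlim ↦ ?_
  choose s t hs ht hst hε using hx
  obtain ⟨s₀, hs₀, φ, hφ, hsφ⟩ := (isCompact_setOf_coe_le T).tendsto_subseq hs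
  obtain ⟨t₀, ht₀, ψ, hψ, htψ⟩ :=
    (isCompact_setOf_coe_le T).tendsto_subseq (x := t ∘ φ) fun n ↦ ht (φ n)
  have hθ : StrictMono (φ ∘ ψ) := hφ.comp hψ
  have hsθ : Tendsto (s ∘ φ ∘ ψ) atTop (𝓝 s₀) := hsφ.comp hψ.tendsto_atTop
  have hlim' : Tendsto (x ∘ φ ∘ ψ) atTop (𝓝 y) := hlim.comp hθ.tendsto_atTop
  refine ⟨s₀, t₀, hs₀, ht₀, ?_, ?_⟩
  · exact le_of_tendsto' (hsθ.dist htψ) fun n ↦ hst _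
  · have h1 : Tendsto (fun n ↦ (x ∘ φ ∘ ψ) n ((s ∘ φ ∘ ψ) n)) atTop (𝓝 (y s₀)) :=
      tendsto_apply_of_tendsto hlim' (fun n ↦ hs _) hsθ
    have h2 : Tendsto (fun n ↦ (x ∘ φ ∘ ψ) n ((t ∘ φ) (ψ n))) atTop (𝓝 (y t₀)) :=
      tendsto_apply_of_tendsto hlim' (fun n ↦ ht _) htψ
    exact ge_of_tendsto' (h1.dist h2) fun n ↦ hε _

/-- **One random continuous path has small bad-modulus probability**: for a finite Borel measure
`μ` on `C(ℝ≥0, E)`, `μ (badModulusSet T (1/(m+1)) ε) → 0` as `m → ∞` (`ε > 0`): the sets decrease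
to `∅` because every path is uniformly continuous on `[0, T]`. Billingsley (1999), proof of
Thm. 7.3 (necessity, "`n₀ = 1`"). [cite: Billingsley1999, Thm. 7.3] -/
theorem tendsto_measure_badModulusSet [MeasurableSpace C(ℝ≥0, E)]
    [OpensMeasurableSpace C(ℝ≥0, E)] (μ : Measure C(ℝ≥0, E)) [IsFiniteMeasure μ] (T : ℝ)
    {ε : ℝ} (hε : 0 < ε) :
    Tendsto (fun m : ℕ ↦ μ (badModulusSet T (1 / ((m : ℝ) + 1)) ε)) atTop (𝓝 0) := by
  have hanti : Antitone fun m : ℕ ↦ (badModulusSet T (1 / ((m : ℝ) + 1)) ε : Set C(ℝ≥0, E)) :=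
    fun m m' hmm' ↦ badModulusSet_mono (by gcongr)
  have hempty : ⋂ m : ℕ, (badModulusSet T (1 / ((m : ℝ) + 1)) ε : Set C(ℝ≥0, E)) = ∅ := by
    ext x
    simp only [mem_iInter, mem_empty_iff_false, iff_false, not_forall]
    have huc : UniformContinuousOn x {s : ℝ≥0 | (s : ℝ) ≤ T} :=
      (isCompact_setOf_coe_le T).uniformContinuousOn_of_continuous x.continuous.continuousOn
    obtain ⟨δ, hδ, hδε⟩ := Metric.uniformContinuousOn_iff.1 huc ε hε
    obtain ⟨m, hm⟩ := exists_nat_one_div_lt hδ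
    refine ⟨m, ?_⟩
    rintro ⟨s, t, hs, ht, hst, hε'⟩
    exact absurd hε' (not_le.2 (hδε s hs t ht (hst.trans_lt hm)))
  have h := tendsto_measure_iInter_atTop (μ := μ)
    (fun m ↦ (isClosed_badModulusSet T _ ε).measurableSet.nullMeasurableSet) hanti
    ⟨0, measure_ne_top μ _⟩
  rw [hempty, measure_empty] at h
  exact h

/-- A finite family of positive reals has a positive lower bound. [folklore] -/
theorem exists_pos_forall_lt_le (δ : ℕ → ℝ) (hδ : ∀ n, 0 < δ n) (N : ℕ) :
    ∃ δ₁ : ℝ, 0 < δ₁ ∧ ∀ n < N, δ₁ ≤ δ n := by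
  induction N with
  | zero => exact ⟨1, one_pos, fun n hn ↦ absurd hn (Nat.not_lt_zero n)⟩
  | succ N ih =>
    obtain ⟨δ₁, hδ₁, h⟩ := ih
    refine ⟨min δ₁ (δ N), lt_min hδ₁ (hδ N), fun n hn ↦ ?_⟩
    rcases Nat.lt_succ_iff_lt_or_eq.1 hn with hn' | rfl
    · exact (min_le_left _ _).trans (h n hn')
    · exact min_le_right _ _

/-- **From "eventually in `n`" to "for all `n`"** (Billingsley (1999), Thm. 7.3, inside its
proof). Let `Xₙ : Ωₙ → C(ℝ≥0, E)` be a.e.-measurable random continuous paths under finite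
measures `Pₙ`. If for some `δ₀ > 0` eventually `Pₙ[Xₙ ∈ badModulusSet T δ₀ ε] ≤ η` (`ε, η > 0`),
then there is `δ > 0` with `Pₙ[Xₙ ∈ badModulusSet T δ ε] ≤ η` for every `n`: the finitely many
exceptional `n` each get their own `δₙ` from `tendsto_measure_badModulusSet`.
[cite: Billingsley1999, Thm. 7.3] -/
theorem exists_forall_measure_badModulusSet_le_of_eventually [MeasurableSpace C(ℝ≥0, E)]
    [OpensMeasurableSpace C(ℝ≥0, E)] {Ω : ℕ → Type*} [∀ n, MeasurableSpace (Ω n)]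
    {P : ∀ n, Measure (Ω n)} [∀ n, IsFiniteMeasure (P n)] {X : ∀ n, Ω n → C(ℝ≥0, E)}
    (hX : ∀ n, AEMeasurable (X n) (P n)) (T : ℝ) {ε : ℝ} (hε : 0 < ε) {η : ℝ≥0∞} (hη : 0 < η)
    (h : ∃ δ : ℝ, 0 < δ ∧ ∀ᶠ n in atTop, P n {ω | X n ω ∈ badModulusSet T δ ε} ≤ η) :
    ∃ δ : ℝ, 0 < δ ∧ ∀ n, P n {ω | X n ω ∈ badModulusSet T δ ε} ≤ η := by
  obtain ⟨δ₀, hδ₀, hev⟩ := h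
  obtain ⟨N, hN⟩ := eventually_atTop.1 hev
  have hn : ∀ n, ∃ δ : ℝ, 0 < δ ∧ P n {ω | X n ω ∈ badModulusSet T δ ε} ≤ η := by
    intro n
    haveI : IsFiniteMeasure ((P n).map (X n)) := Measure.isFiniteMeasure_map (P n) (X n)
    have ht := tendsto_measure_badModulusSet ((P n).map (X n)) T hε
    obtain ⟨m, hm⟩ := (ht.eventually (Iio_mem_nhds hη)).exists
    refine ⟨1 / ((m : ℝ) + 1), by positivity, ?_⟩
    rw [Measure.map_apply_of_aemeasurable (hX n) (isClosed_badModulusSet T _ ε).measurableSet]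
      at hm
    exact hm.le
  choose δ hδ hδP using hn
  obtain ⟨δ₁, hδ₁, hδ₁le⟩ := exists_pos_forall_lt_le δ hδ N
  refine ⟨min δ₀ δ₁, lt_min hδ₀ hδ₁, fun n ↦ ?_⟩
  rcases lt_or_ge n N with hn | hn
  · refine (measure_mono ?_).trans (hδP n)
    exact fun ω hω ↦ badModulusSet_mono ((min_le_right _ _).trans (hδ₁le n hn)) hω
  · refine (measure_mono ?_).trans (hN n hn)
    exact fun ω hω ↦ badModulusSet_mono (min_le_left _ _) hω

/-- The same upgrade in the fully quantified form used by tightness criteria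
(`PathSpaceTightness.isTightMeasureSet_range_map_of_modulus`, hypothesis `hmod`): a modulus
bound holding eventually in `n` for every `(T, ε, η)` holds for all `n` (a.e.-measurable paths,
finite measures). [cite: Billingsley1999, Thm. 7.3] -/
theorem forall_measure_modulus_le_of_eventually [MeasurableSpace C(ℝ≥0, E)]
    [OpensMeasurableSpace C(ℝ≥0, E)] {Ω : ℕ → Type*} [∀ n, MeasurableSpace (Ω n)]
    {P : ∀ n, Measure (Ω n)} [∀ n, IsFiniteMeasure (P n)] {X : ∀ n, Ω n → C(ℝ≥0, E)}
    (hX : ∀ n, AEMeasurable (X n) (P n))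
    (h : ∀ (T ε : ℝ), 0 < ε → ∀ η : ℝ≥0∞, 0 < η → ∃ δ : ℝ, 0 < δ ∧ ∀ᶠ n in atTop,
      P n {ω | ∃ s t : ℝ≥0, (s : ℝ) ≤ T ∧ (t : ℝ) ≤ T ∧ dist s t ≤ δ ∧
        ε ≤ dist (X n ω s) (X n ω t)} ≤ η)
    (T ε : ℝ) (hε : 0 < ε) (η : ℝ≥0∞) (hη : 0 < η) :
    ∃ δ : ℝ, 0 < δ ∧ ∀ n, P n {ω | ∃ s t : ℝ≥0, (s : ℝ) ≤ T ∧ (t : ℝ) ≤ T ∧ dist s t ≤ δ ∧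
      ε ≤ dist (X n ω s) (X n ω t)} ≤ η :=
  exists_forall_measure_badModulusSet_le_of_eventually hX T hε hη (h T ε hε η hη)

end Literature.Probability.Process
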